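import Mathlib
import HarnessLib
import Literature.Probability.LatticeModels.IsingThermodynamics
import Summits.CriticalPhenomena.Ising3DConformalLimit.Theorems.PrecisionLaplacianDirectCorrelationStableTailPointwiseUpgradeAux

/-!
# Helpers (III) for the stub `stub_pointwiseUpgrade` of line `self-energy-pick-inversion`
(crux `PrecisionLaplacian.DirectCorrelationStableTail`, item stmt-CriticalPhenomena-4799)

The UNIFORMITY and NON-DEGENERACY steps of the soft-analysis upgrade.  Given a profile
`h : ℤ³ → ℝ` satisfying the rounding lemma (conclusion of `approx_rounding`) and a function `Φ` on
the unit sphere with `h ⌊N u⌋ → Φ u` for every unit vector `u`: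
* `rounding_pair_close`, `continuousOn_profileLimit`: `Φ` is (uniformly) continuous on the sphere;
* `profile_uniform`: the convergence `h ⌊N u⌋ → Φ u` is uniform in `u` (finite net of the compact
  sphere);
* `tendsto_profile_cofinite`: `h x - Φ (x / |x|₂) → 0` along the cofinite filter of `ℤ³`;
* `profileLimit_nonneg`: `Φ ≥ 0` on the sphere when `h = a |·|₂^{5-η}` with `a ≥ 0` off `0`;
* `false_of_profile_small`: `h → 0` at infinity contradicts the radial asymptotics
  `S⁽⁰⁾(n) n^{3-η} → c > 0` of the slab sums, given slab tightness (R3).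

No definitions are introduced; all statements are folklore soft analysis.
-/

noncomputable section

namespace Summit.CriticalPhenomena.Ising3DConformalLimit.Cruxes.DirectCorrelationStableTail.SelfEnergyPickInversion

open MeasureTheory Filter Topology
open scoped BigOperators Pointwise
open Literature.Probability.LatticeModels

/-! ### Continuity of the limit profile on the sphere -/

/-- Rounded rays of nearby unit vectors carry nearby values of `h` (from the rounding lemma).
[folklore] -/
theorem rounding_pair_close (h : Site 3 → ℝ)
    (hG : ∀ ε : ℝ, 0 < ε → ∃ δ' : ℝ, 0 < δ' ∧ ∃ N₁ : ℕ, ∀ N : ℕ, N₁ ≤ N → ∀ u : Fin 3 → ℝ,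
      ∑ i, u i ^ 2 = 1 → ∀ y : Site 3, ‖(fun j => (y j : ℝ) - N * u j)‖ ≤ δ' * N →
      |h y - h (fun i => ⌊(N : ℝ) * u i⌋)| ≤ ε)
    {ε : ℝ} (hε : 0 < ε) :
    ∃ θ : ℝ, 0 < θ ∧ ∃ N₂ : ℕ, ∀ N : ℕ, N₂ ≤ N → ∀ u v : Fin 3 → ℝ, ∑ i, u i ^ 2 = 1 →
      ∑ i, v i ^ 2 = 1 → ‖u - v‖ ≤ θ →
      |h (fun i => ⌊(N : ℝ) * v i⌋) - h (fun i => ⌊(N : ℝ) * u i⌋)| ≤ ε := by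
  obtain ⟨δ', hδ', N₁, hN₁⟩ := hG ε hε
  refine ⟨δ' / 2, by positivity, max N₁ ⌈2 / δ'⌉₊, fun N hN u v hu _ huv => ?_⟩
  refine hN₁ N ((le_max_left _ _).trans hN) u hu (fun i => ⌊(N : ℝ) * v i⌋) ?_
  have hN' : (2 / δ' : ℝ) ≤ N :=
    (Nat.le_ceil _).trans (by exact_mod_cast (le_max_right _ _).trans hN)
  have hN0 : (0 : ℝ) ≤ N := Nat.cast_nonneg N
  have h1 : ‖(fun j => (((⌊(N : ℝ) * v j⌋ : ℤ)) : ℝ) - N * u j)‖ ≤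
      ‖(fun j => ((⌊(N : ℝ) * v j⌋ : ℤ) : ℝ) - N * v j)‖ + ‖(fun j => (N : ℝ) * v j - N * u j)‖ :=
    norm_sub_le_norm_sub_add_norm_sub (fun j => ((⌊(N : ℝ) * v j⌋ : ℤ) : ℝ))
      (fun j => (N : ℝ) * v j) (fun j => (N : ℝ) * u j)
  have h2 : ‖(fun j => ((⌊(N : ℝ) * v j⌋ : ℤ) : ℝ) - N * v j)‖ ≤ 1 :=
    norm_floor_sub_le (fun j => (N : ℝ) * v j)
  have h3 : ‖(fun j => (N : ℝ) * v j - N * u j)‖ ≤ N * (δ' / 2) := by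
    have e : (fun j => (N : ℝ) * v j - N * u j) = (N : ℝ) • (v - u) := by
      funext j
      simp [mul_sub]
    rw [e, norm_smul, Real.norm_eq_abs, abs_of_nonneg hN0, norm_sub_rev]
    exact mul_le_mul_of_nonneg_left huv hN0
  have h4 : (1 : ℝ) ≤ N * (δ' / 2) := by
    have e : (1 : ℝ) = 2 / δ' * (δ' / 2) := by
      field_simp
    rw [e]
    exact mul_le_mul_of_nonneg_right hN' (by positivity)
  show ‖(fun j => (((⌊(N : ℝ) * v j⌋ : ℤ)) : ℝ) - N * u j)‖ ≤ δ' * N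
  linarith

/-- **Continuity of the limit profile on the unit sphere.** [folklore] -/
theorem continuousOn_profileLimit (h : Site 3 → ℝ) (Φ : (Fin 3 → ℝ) → ℝ)
    (hG : ∀ ε : ℝ, 0 < ε → ∃ δ' : ℝ, 0 < δ' ∧ ∃ N₁ : ℕ, ∀ N : ℕ, N₁ ≤ N → ∀ u : Fin 3 → ℝ,
      ∑ i, u i ^ 2 = 1 → ∀ y : Site 3, ‖(fun j => (y j : ℝ) - N * u j)‖ ≤ δ' * N →
      |h y - h (fun i => ⌊(N : ℝ) * u i⌋)| ≤ ε)
    (hΦ : ∀ u : Fin 3 → ℝ, ∑ i, u i ^ 2 = 1 →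
      Tendsto (fun N : ℕ => h (fun i => ⌊(N : ℝ) * u i⌋)) atTop (𝓝 (Φ u))) :
    ContinuousOn Φ {u | ∑ i, u i ^ 2 = 1} := by
  refine Metric.continuousOn_iff.2 fun u hu ε hε => ?_
  obtain ⟨θ, hθ, N₂, hN₂⟩ := rounding_pair_close h hG (half_pos hε)
  refine ⟨θ, hθ, fun v hv huv => ?_⟩
  have hlim : Tendsto (fun N : ℕ => |h (fun i => ⌊(N : ℝ) * v i⌋) - h (fun i => ⌊(N : ℝ) * u i⌋)|)
      atTop (𝓝 |Φ v - Φ u|) := ((hΦ v hv).sub (hΦ u hu)).abs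
  have huv' : ‖u - v‖ ≤ θ := by
    rw [dist_eq_norm, norm_sub_rev] at huv
    exact huv.le
  have hle : |Φ v - Φ u| ≤ ε / 2 :=
    le_of_tendsto hlim (eventually_atTop.2 ⟨N₂, fun N hN => hN₂ N hN u v hu hv huv'⟩)
  rw [Real.dist_eq]
  linarith

/-! ### Uniform convergence along rounded rays -/

/-- **Uniformity.** The convergence `h ⌊N u⌋ → Φ u` is uniform over the unit sphere (finite net of
the compact sphere + the rounding lemma). [folklore] -/
theorem profile_uniform (h : Site 3 → ℝ) (Φ : (Fin 3 → ℝ) → ℝ)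
    (hG : ∀ ε : ℝ, 0 < ε → ∃ δ' : ℝ, 0 < δ' ∧ ∃ N₁ : ℕ, ∀ N : ℕ, N₁ ≤ N → ∀ u : Fin 3 → ℝ,
      ∑ i, u i ^ 2 = 1 → ∀ y : Site 3, ‖(fun j => (y j : ℝ) - N * u j)‖ ≤ δ' * N →
      |h y - h (fun i => ⌊(N : ℝ) * u i⌋)| ≤ ε)
    (hΦ : ∀ u : Fin 3 → ℝ, ∑ i, u i ^ 2 = 1 →
      Tendsto (fun N : ℕ => h (fun i => ⌊(N : ℝ) * u i⌋)) atTop (𝓝 (Φ u)))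
    {ε : ℝ} (hε : 0 < ε) :
    ∃ N₃ : ℕ, ∀ N : ℕ, N₃ ≤ N → ∀ u : Fin 3 → ℝ, ∑ i, u i ^ 2 = 1 →
      |h (fun i => ⌊(N : ℝ) * u i⌋) - Φ u| ≤ ε := by
  obtain ⟨θ, hθ, N₂, hN₂⟩ := rounding_pair_close h hG (show 0 < ε / 3 by positivity)
  have hlim : ∀ u v : Fin 3 → ℝ, ∑ i, u i ^ 2 = 1 → ∑ i, v i ^ 2 = 1 → ‖u - v‖ ≤ θ →
      |Φ v - Φ u| ≤ ε / 3 := fun u v hu hv huv =>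
    le_of_tendsto ((hΦ v hv).sub (hΦ u hu)).abs
      (eventually_atTop.2 ⟨N₂, fun N hN => hN₂ N hN u v hu hv huv⟩)
  have hpt : ∀ v : Fin 3 → ℝ, ∃ Nv : ℕ, ∑ i, v i ^ 2 = 1 → ∀ N : ℕ, Nv ≤ N →
      |h (fun i => ⌊(N : ℝ) * v i⌋) - Φ v| ≤ ε / 3 := by
    intro v
    by_cases hv : ∑ i, v i ^ 2 = 1
    · obtain ⟨Nv, hNv⟩ := Metric.tendsto_atTop.1 (hΦ v hv) (ε / 3) (by positivity)
      refine ⟨Nv, fun _ N hN => ?_⟩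
      have := hNv N hN
      rw [Real.dist_eq] at this
      exact this.le
    · exact ⟨0, fun h' => absurd h' hv⟩
  choose Nv hNv using hpt
  obtain ⟨t, htS, hcover⟩ := isCompact_sphere_set.elim_nhds_subcover (fun v => Metric.ball v θ)
    (fun v _ => Metric.ball_mem_nhds v hθ)
  refine ⟨max N₂ (t.sup Nv), fun N hN u hu => ?_⟩
  obtain ⟨v, hvt, huv⟩ : ∃ v ∈ t, u ∈ Metric.ball v θ := by
    simpa only [Set.mem_iUnion, exists_prop] using hcover hu
  have hv : ∑ i, v i ^ 2 = 1 := htS v hvt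
  have huv' : ‖v - u‖ ≤ θ := by
    rw [Metric.mem_ball, dist_eq_norm, norm_sub_rev] at huv
    exact huv.le
  have h1 : |h (fun i => ⌊(N : ℝ) * u i⌋) - h (fun i => ⌊(N : ℝ) * v i⌋)| ≤ ε / 3 :=
    hN₂ N ((le_max_left _ _).trans hN) v u hv hu huv'
  have h2 : |h (fun i => ⌊(N : ℝ) * v i⌋) - Φ v| ≤ ε / 3 :=
    hNv v hv N ((Finset.le_sup hvt).trans ((le_max_right _ _).trans hN))
  have h3 : |Φ u - Φ v| ≤ ε / 3 := hlim v u hv hu huv'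
  rw [abs_le] at h1 h2 h3 ⊢
  constructor <;> linarith [h1.1, h1.2, h2.1, h2.2, h3.1, h3.2]

/-! ### The cofinite statement -/

/-- **Stable tail along the cofinite filter.** `h x - Φ (x / |x|₂) → 0` as `x → ∞` in `ℤ³`.
[folklore] -/
theorem tendsto_profile_cofinite (h : Site 3 → ℝ) (Φ : (Fin 3 → ℝ) → ℝ)
    (hG : ∀ ε : ℝ, 0 < ε → ∃ δ' : ℝ, 0 < δ' ∧ ∃ N₁ : ℕ, ∀ N : ℕ, N₁ ≤ N → ∀ u : Fin 3 → ℝ,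
      ∑ i, u i ^ 2 = 1 → ∀ y : Site 3, ‖(fun j => (y j : ℝ) - N * u j)‖ ≤ δ' * N →
      |h y - h (fun i => ⌊(N : ℝ) * u i⌋)| ≤ ε)
    (hΦ : ∀ u : Fin 3 → ℝ, ∑ i, u i ^ 2 = 1 →
      Tendsto (fun N : ℕ => h (fun i => ⌊(N : ℝ) * u i⌋)) atTop (𝓝 (Φ u))) :
    Tendsto (fun x : Site 3 => h x - Φ (fun i => (x i : ℝ) / √(∑ j, ((x j : ℝ)) ^ 2)))
      cofinite (𝓝 0) := by
  refine Metric.tendsto_nhds.2 fun ε hε => ?_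
  obtain ⟨δ', hδ', N₁, hN₁⟩ := hG (ε / 3) (by positivity)
  obtain ⟨N₃, hN₃⟩ := profile_uniform h Φ hG hΦ (show 0 < ε / 3 by positivity)
  filter_upwards [tendsto_sqrt_sum_sq_cofinite.eventually
    (eventually_ge_atTop ((N₁ : ℝ) + N₃ + 1 / δ' + 2))] with x hx
  set E : ℝ := √(∑ j, ((x j : ℝ)) ^ 2) with hE_def
  have hδi : (0 : ℝ) < 1 / δ' := by positivity
  have hEpos : 0 < E := by
    have : (0 : ℝ) ≤ (N₁ : ℝ) + N₃ := by positivity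
    linarith
  set N : ℕ := ⌊E⌋₊ with hN_def
  have hNE : (N : ℝ) ≤ E := Nat.floor_le hEpos.le
  have hEN : E < N + 1 := Nat.lt_floor_add_one E
  have hN0 : (0 : ℝ) ≤ N := Nat.cast_nonneg N
  set u : Fin 3 → ℝ := fun i => (x i : ℝ) / E with hu_def
  have hu : ∑ i, u i ^ 2 = 1 := by
    simp only [hu_def, div_pow]
    rw [← Finset.sum_div, hE_def, Real.sq_sqrt (Finset.sum_nonneg fun j _ => sq_nonneg _),
      div_self]
    intro h0
    rw [hE_def, h0, Real.sqrt_zero] at hEpos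
    exact lt_irrefl _ hEpos
  have hN1 : N₁ ≤ N := by
    have : (N₁ : ℝ) ≤ N := by
      have : (0 : ℝ) ≤ N₃ := Nat.cast_nonneg N₃
      linarith
    exact_mod_cast this
  have hN3 : N₃ ≤ N := by
    have : (N₃ : ℝ) ≤ N := by
      have : (0 : ℝ) ≤ N₁ := Nat.cast_nonneg N₁
      linarith
    exact_mod_cast this
  have hNδ : 1 ≤ δ' * N := by
    have h1 : 1 / δ' ≤ (N : ℝ) := by
      have : (0 : ℝ) ≤ (N₁ : ℝ) + N₃ := by positivity
      linarith
    calc (1 : ℝ) = δ' * (1 / δ') := by field_simp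
      _ ≤ δ' * N := mul_le_mul_of_nonneg_left h1 hδ'.le
  have h1 : |h x - h (fun i => ⌊(N : ℝ) * u i⌋)| ≤ ε / 3 := by
    refine hN₁ N hN1 u hu x ?_
    have hcoord : ∀ j, |(x j : ℝ) - N * u j| ≤ E - N := by
      intro j
      have e : (x j : ℝ) - N * u j = (x j : ℝ) * ((E - N) / E) := by
        simp only [hu_def]
        field_simp
      rw [e, abs_mul, abs_of_nonneg (div_nonneg (by linarith) hEpos.le)]
      calc |(x j : ℝ)| * ((E - N) / E) ≤ E * ((E - N) / E) :=
            mul_le_mul_of_nonneg_right (abs_apply_le_sqrt_sum_sq (fun j => (x j : ℝ)) j)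
              (div_nonneg (by linarith) hEpos.le)
        _ = E - N := by field_simp
    calc ‖(fun j => (x j : ℝ) - N * u j)‖ ≤ E - N :=
          (pi_norm_le_iff_of_nonneg (by linarith)).2 fun j => by
            rw [Real.norm_eq_abs]
            exact hcoord j
      _ ≤ 1 := by linarith
      _ ≤ δ' * N := hNδ
  have h2 : |h (fun i => ⌊(N : ℝ) * u i⌋) - Φ u| ≤ ε / 3 := hN₃ N hN3 u hu
  rw [dist_zero_right, Real.norm_eq_abs, abs_lt]
  rw [abs_le] at h1 h2
  constructor <;> linarith [h1.1, h1.2, h2.1, h2.2]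

/-! ### Sign and non-degeneracy of the limit profile -/

/-- **Nonnegativity.** If `h = a |·|₂^{5-η}` with `a ≥ 0` off the origin then `Φ ≥ 0` on the
sphere. [folklore] -/
theorem profileLimit_nonneg (a : Site 3 → ℝ) (η : ℝ) (h : Site 3 → ℝ)
    (hh : ∀ x, h x = a x * √(∑ j, ((x j : ℝ)) ^ 2) ^ (5 - η)) (ha : ∀ x : Site 3, x ≠ 0 → 0 ≤ a x)
    (Φ : (Fin 3 → ℝ) → ℝ) (hΦ : ∀ u : Fin 3 → ℝ, ∑ i, u i ^ 2 = 1 →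
      Tendsto (fun N : ℕ => h (fun i => ⌊(N : ℝ) * u i⌋)) atTop (𝓝 (Φ u)))
    {u : Fin 3 → ℝ} (hu : ∑ i, u i ^ 2 = 1) : 0 ≤ Φ u := by
  refine ge_of_tendsto (hΦ u hu) (eventually_atTop.2 ⟨3, fun N hN => ?_⟩)
  have hr : (fun i => ⌊(N : ℝ) * u i⌋ : Site 3) ≠ 0 := by
    intro h0
    have h1 := sub_two_le_sqrt_sum_sq_floor hu (Nat.cast_nonneg N)
    have h2 : ∀ j, ((⌊(N : ℝ) * u j⌋ : ℤ) : ℝ) = 0 := fun j => by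
      have := congr_fun h0 j
      simp only [Pi.zero_apply] at this
      simp [this]
    simp only [h2] at h1
    have h3 : (3 : ℝ) ≤ N := by exact_mod_cast hN
    norm_num at h1
    linarith
  show 0 ≤ h (fun i => ⌊(N : ℝ) * u i⌋)
  rw [hh]
  exact mul_nonneg (ha _ hr) (Real.rpow_nonneg (Real.sqrt_nonneg _) _)

/-- **Non-degeneracy via the slab sums.** If `h = a |·|₂^{5-η}` (`a ≥ 0` off `0`, `η < 1`) tends
to `0` at infinity, then slab tightness (R3) bounds the slab sums `S(n) = ∑' a(n, y)` by
`o(n^{-(3-η)})`, contradicting the radial asymptotics `S(n) n^{3-η} → c > 0`. [folklore] -/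
theorem false_of_profile_small (a : Site 3 → ℝ) (η c : ℝ) (h : Site 3 → ℝ)
    (hh : ∀ x, h x = a x * √(∑ j, ((x j : ℝ)) ^ 2) ^ (5 - η)) (ha : ∀ x : Site 3, x ≠ 0 → 0 ≤ a x)
    (hη : η < 1) (hc : 0 < c)
    (hRad : ∀ i : Fin 3, Filter.Tendsto (fun n : ℕ =>
      (∑' y : Fin 2 → ℤ, a (Fin.insertNth i (n : ℤ) (y) : Site 3)) * (n : ℝ) ^ (3 - η))
      Filter.atTop (nhds c))
    (hR3 : ∀ ε : ℝ, 0 < ε → ∃ K : ℝ, 0 < K ∧ ∃ N₀ : ℕ, ∀ (i : Fin 3) (n : ℕ), N₀ ≤ n →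
      (∑' y : Fin 2 → ℤ, if K * (n : ℝ) < ‖y‖ then a (Fin.insertNth i (n : ℤ) (y) : Site 3) else 0)
        ≤ ε * (∑' y : Fin 2 → ℤ, a (Fin.insertNth i (n : ℤ) (y) : Site 3)))
    (hsmall : ∀ ε : ℝ, 0 < ε → ∃ R : ℝ, ∀ x : Site 3, R ≤ √(∑ j, ((x j : ℝ)) ^ 2) → h x ≤ ε) :
    False := by
  obtain ⟨K, hK, N₀, hN₀⟩ := hR3 (1 / 2) one_half_pos
  set C : ℝ := 2 * (2 * K + 3) ^ 2 with hC_def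
  have hCpos : 0 < C := by positivity
  obtain ⟨R, hR⟩ := hsmall (c / (2 * C)) (by positivity)
  obtain ⟨Na, hNa⟩ := eventually_atTop.1 ((hRad 0).eventually (lt_mem_nhds (half_lt_self hc)))
  set n : ℕ := max (max N₀ Na) (max ⌈R⌉₊ 1) with hn_def
  have hn0 : N₀ ≤ n := (le_max_left _ _).trans (le_max_left _ _)
  have hna : Na ≤ n := (le_max_right _ _).trans (le_max_left _ _)
  have hn1 : 1 ≤ n := (le_max_right _ _).trans (le_max_right _ _)
  have hnR : R ≤ n := (Nat.le_ceil R).trans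
    (by exact_mod_cast (le_max_left _ _).trans (le_max_right (max N₀ Na) _))
  have hnpos : (0 : ℝ) < n := by exact_mod_cast hn1
  have hn1' : (1 : ℝ) ≤ n := by exact_mod_cast hn1
  -- the slab family and its pointwise bound
  have hx0 : ∀ y : Fin 2 → ℤ, (Fin.insertNth 0 (n : ℤ) (y) : Site 3) ≠ 0 := fun y h0 => by
    have := congr_fun h0 0
    rw [Fin.insertNth_apply_same, Pi.zero_apply] at this
    omega
  have hs0 : ∀ y : Fin 2 → ℤ, 0 ≤ a (Fin.insertNth 0 (n : ℤ) (y) : Site 3) := fun y => ha _ (hx0 y)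
  have hsle : ∀ y : Fin 2 → ℤ,
      a (Fin.insertNth 0 (n : ℤ) (y) : Site 3) ≤ c / (2 * C) * (n : ℝ) ^ (η - 5) := by
    intro y
    set x : Site 3 := Fin.insertNth 0 (n : ℤ) (y) with hx_def
    have hx0 : x 0 = n := by simp [hx_def]
    have hEx : (n : ℝ) ≤ √(∑ j, ((x j : ℝ)) ^ 2) := by
      have h1 : |((x 0 : ℤ) : ℝ)| ≤ √(∑ j, ((x j : ℝ)) ^ 2) :=
        abs_apply_le_sqrt_sum_sq (fun j => (x j : ℝ)) 0
      rw [hx0, Int.cast_natCast, Nat.abs_cast] at h1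
      exact h1
    have hEpos : 0 < √(∑ j, ((x j : ℝ)) ^ 2) := hnpos.trans_le hEx
    have hax : a x = h x * √(∑ j, ((x j : ℝ)) ^ 2) ^ (η - 5) := by
      rw [hh x, show η - 5 = -(5 - η) by ring, Real.rpow_neg hEpos.le,
        mul_inv_cancel_right₀ (Real.rpow_pos_of_pos hEpos _).ne']
    rw [hax]
    calc h x * √(∑ j, ((x j : ℝ)) ^ 2) ^ (η - 5)
        ≤ c / (2 * C) * √(∑ j, ((x j : ℝ)) ^ 2) ^ (η - 5) :=
          mul_le_mul_of_nonneg_right (hR x (hnR.trans hEx)) (Real.rpow_nonneg hEpos.le _)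
      _ ≤ c / (2 * C) * (n : ℝ) ^ (η - 5) :=
          mul_le_mul_of_nonneg_left (Real.rpow_le_rpow_of_nonpos hnpos hEx (by linarith))
            (by positivity)
  have hSgt : c / 2 < (∑' y : Fin 2 → ℤ, a (Fin.insertNth 0 (n : ℤ) (y) : Site 3)) *
      (n : ℝ) ^ (3 - η) := hNa n hna
  by_cases hsum : Summable fun y : Fin 2 → ℤ => a (Fin.insertNth 0 (n : ℤ) (y) : Site 3)
  · set t : (Fin 2 → ℤ) → ℝ := fun y =>
      if K * (n : ℝ) < ‖y‖ then a (Fin.insertNth 0 (n : ℤ) (y) : Site 3) else 0 with ht_def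
    set b : (Fin 2 → ℤ) → ℝ := fun y =>
      if K * (n : ℝ) < ‖y‖ then 0 else a (Fin.insertNth 0 (n : ℤ) (y) : Site 3) with hb_def
    have ht0 : ∀ y, 0 ≤ t y := fun y => by
      simp only [ht_def]
      split_ifs <;> [exact hs0 y; exact le_rfl]
    have hb0 : ∀ y, 0 ≤ b y := fun y => by
      simp only [hb_def]
      split_ifs <;> [exact le_rfl; exact hs0 y]
    have htle : ∀ y, t y ≤ a (Fin.insertNth 0 (n : ℤ) (y) : Site 3) := fun y => by
      simp only [ht_def]
      split_ifs <;> [exact le_rfl; exact hs0 y]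
    have hble : ∀ y, b y ≤ a (Fin.insertNth 0 (n : ℤ) (y) : Site 3) := fun y => by
      simp only [hb_def]
      split_ifs <;> [exact hs0 y; exact le_rfl]
    have hts : Summable t := hsum.of_nonneg_of_le ht0 htle
    have hbs : Summable b := hsum.of_nonneg_of_le hb0 hble
    have hsplit : ∑' y : Fin 2 → ℤ, a (Fin.insertNth 0 (n : ℤ) (y) : Site 3) =
        ∑' y, t y + ∑' y, b y := by
      rw [← hts.tsum_add hbs]
      refine tsum_congr fun y => ?_
      simp only [ht_def, hb_def]
      split_ifs <;> simp
    have ht_half : ∑' y, t y ≤ 1 / 2 * ∑' y : Fin 2 → ℤ, a (Fin.insertNth 0 (n : ℤ) (y) : Site 3) :=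
      hN₀ 0 n hn0
    -- the bounded part is a finite sum over the box `‖y‖∞ ≤ K n`
    have hbox : ∀ y : Fin 2 → ℤ,
        y ∉ Fintype.piFinset (fun _ : Fin 2 => Finset.Icc (-⌈K * n⌉) ⌈K * n⌉) → b y = 0 := by
      intro y hy
      have hlt : K * n < ‖y‖ := by
        by_contra hle
        push Not at hle
        refine hy (mem_box_of_abs_le (K * n) y fun j => ?_)
        have := norm_le_pi_norm y j
        rw [Int.norm_eq_abs] at this
        exact this.trans hle
      simp only [hb_def, hlt, if_true]
    have hcard : (((Fintype.piFinset fun _ : Fin 2 => Finset.Icc (-⌈K * (n : ℝ)⌉) ⌈K * (n : ℝ)⌉)).card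
        : ℝ) ≤ ((2 * K + 3) * n) ^ 2 := by
      rw [Fintype.card_piFinset, Finset.prod_const, Finset.card_univ, Fintype.card_fin, Int.card_Icc]
      have h0 : (0 : ℤ) ≤ ⌈K * (n : ℝ)⌉ := Int.ceil_nonneg (by positivity)
      have h1 : ⌈K * (n : ℝ)⌉ + 1 - -⌈K * (n : ℝ)⌉ = 2 * ⌈K * (n : ℝ)⌉ + 1 := by ring
      have h2 : (((2 * ⌈K * (n : ℝ)⌉ + 1).toNat : ℕ) : ℝ) = 2 * (⌈K * (n : ℝ)⌉ : ℝ) + 1 := by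
        have h3 : (((2 * ⌈K * (n : ℝ)⌉ + 1).toNat : ℤ) : ℝ) = ((2 * ⌈K * (n : ℝ)⌉ + 1 : ℤ) : ℝ) := by
          rw [Int.toNat_of_nonneg (by linarith)]
        have h4 : (((2 * ⌈K * (n : ℝ)⌉ + 1).toNat : ℕ) : ℝ) =
            (((2 * ⌈K * (n : ℝ)⌉ + 1).toNat : ℤ) : ℝ) := (Int.cast_natCast _).symm
        rw [h4, h3]
        push_cast
        ring
      rw [h1]
      push_cast
      rw [h2]
      have h5 : (⌈K * (n : ℝ)⌉ : ℝ) < K * n + 1 := Int.ceil_lt_add_one _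
      have h6 : (0 : ℝ) ≤ 2 * (⌈K * (n : ℝ)⌉ : ℝ) + 1 := by exact_mod_cast (show (0:ℤ) ≤ 2 * ⌈K * (n : ℝ)⌉ + 1 by linarith)
      have h7 : 2 * (⌈K * (n : ℝ)⌉ : ℝ) + 1 ≤ (2 * K + 3) * n := by nlinarith
      exact pow_le_pow_left₀ h6 h7 2
    have hb_le : ∑' y, b y ≤ ((2 * K + 3) * n) ^ 2 * (c / (2 * C) * (n : ℝ) ^ (η - 5)) := by
      rw [tsum_eq_sum hbox]
      refine (Finset.sum_le_card_nsmul _ _ (c / (2 * C) * (n : ℝ) ^ (η - 5))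
        fun y _ => (hble y).trans (hsle y)).trans ?_
      rw [nsmul_eq_mul]
      exact mul_le_mul_of_nonneg_right hcard (by positivity)
    -- assemble: `S ≤ S/2 + (c/2/C) C/2 n^{η-3}` hence `S n^{3-η} ≤ c/2`
    have hS : ∑' y : Fin 2 → ℤ, a (Fin.insertNth 0 (n : ℤ) (y) : Site 3) ≤
        2 * (((2 * K + 3) * n) ^ 2 * (c / (2 * C) * (n : ℝ) ^ (η - 5))) := by
      linarith
    have hpow : (n : ℝ) ^ 2 * (n : ℝ) ^ (η - 5) * (n : ℝ) ^ (3 - η) = 1 := by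
      rw [← Real.rpow_natCast, ← Real.rpow_add hnpos, ← Real.rpow_add hnpos]
      have : ((2 : ℕ) : ℝ) + (η - 5) + (3 - η) = 0 := by
        push_cast
        ring
      rw [this, Real.rpow_zero]
    have hfinal : (∑' y : Fin 2 → ℤ, a (Fin.insertNth 0 (n : ℤ) (y) : Site 3)) * (n : ℝ) ^ (3 - η)
        ≤ c / 2 := by
      calc (∑' y : Fin 2 → ℤ, a (Fin.insertNth 0 (n : ℤ) (y) : Site 3)) * (n : ℝ) ^ (3 - η)
          ≤ 2 * (((2 * K + 3) * n) ^ 2 * (c / (2 * C) * (n : ℝ) ^ (η - 5))) * (n : ℝ) ^ (3 - η) :=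
            mul_le_mul_of_nonneg_right hS (Real.rpow_nonneg hnpos.le _)
        _ = c / 2 * ((2 * (2 * K + 3) ^ 2) / C) *
            ((n : ℝ) ^ 2 * (n : ℝ) ^ (η - 5) * (n : ℝ) ^ (3 - η)) := by ring
        _ = c / 2 := by rw [hpow, ← hC_def, div_self hCpos.ne']; ring
    linarith
  · rw [tsum_eq_zero_of_not_summable hsum, zero_mul] at hSgt
    linarith

/-- **Registered helper sub-goal `stub_pointwiseUpgrade_auxCofinite`** of stub `stub_pointwiseUpgrade`
(line `self-energy-pick-inversion`, crux stmt-CriticalPhenomena-4799): a profile `h` satisfying the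
rounding lemma, with `h ⌊N u⌋ → Φ u` for every unit vector `u`, has the stable tail
`h x - Φ (x / |x|₂) → 0` along the cofinite filter of `ℤ³`. [folklore] -/
theorem stub_pointwiseUpgrade_auxCofinite :
    ∀ (h : Site 3 → ℝ) (Φ : (Fin 3 → ℝ) → ℝ), (∀ ε : ℝ, 0 < ε → ∃ δ' : ℝ, 0 < δ' ∧ ∃ N₁ : ℕ, ∀ N :
      ℕ, N₁ ≤ N → ∀ u : Fin 3 → ℝ, ∑ i, u i ^ 2 = 1 → ∀ y : Site 3, ‖(fun j => (y j : ℝ) - (N : ℝ) *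
      u j)‖ ≤ δ' * (N : ℝ) → |h y - h (fun i => ⌊(N : ℝ) * u i⌋)| ≤ ε) → (∀ u : Fin 3 → ℝ, ∑ i, u i
      ^ 2 = 1 → Filter.Tendsto (fun N : ℕ => h (fun i => ⌊(N : ℝ) * u i⌋)) Filter.atTop (nhds (Φ
      u))) → Filter.Tendsto (fun x : Site 3 => h x - Φ (fun i => (x i : ℝ) / Real.sqrt (∑ j, ((x) j
      : ℝ) ^ 2))) Filter.cofinite (nhds 0) :=
  fun h Φ hG hΦ => tendsto_profile_cofinite h Φ hG hΦ

end Summit.CriticalPhenomena.Ising3DConformalLimit.Cruxes.DirectCorrelationStableTail.SelfEnergyPickInversion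

end
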